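import Summits.Schanuel.Schanuel.Theorems.ZilberEacDensityRealSlopeLemmas
import HarnessLib

/-!
# Real-slope line × arbitrary plane curve I: the twisted curve function and monomial domination

HONEST FRAMING.  First of three files proving modest rungs of the case ladder of ZILBER'S
EXPONENTIAL-ALGEBRAIC CLOSEDNESS conjecture (EAC), host summit Schanuel, cell `pub-schanuel`
(seat 1, gen 11): the split surfaces `W = {x₁ = a x₀ + b} × Z(P) ⊆ ℂ² × ℂ²` — a line of REAL
irrational slope `a` times an ARBITRARY plane curve `Z(P)`, `P ∈ ℂ[y₀, y₁]` (not necessarily a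
graph `y₀ = q(y₁)`; singular points allowed).  Main results: `ZilberEacRealFibreZeros` (existence
of exponential points — IN PRINT for `n = 2`: Mantova–Masser, PLMS 129 (2024) Thm 1.2; for split
varieties Gallinaro, Selecta Math. 29 (2023) Thm 8.8 — re-proved by an elementary method that also
yields the accumulation structure) and `ZilberEacRealFibreDensity` (Zariski density of the
exponential points: an instance class of Mantova–Masser's OPEN "unprojected density" question,
arXiv:2303.05592 p. 5).  NOT Schanuel's conjecture, which is neither used nor implied (EAC ⇏ SC);
`EC(3,2)` and the density question in general remain OPEN.

This file (from Mathlib and the proved kit `ZilberEacDensityRealSlopeLemmas` only):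
* Part A — `Φ_u(ζ) = P(e^ζ, u e^{aζ+b})` (`curveFn`): window periodicity
  `Φ_u(ζ + 2πi n) = Φ_{u e^{2πi n a}}(ζ)`, holomorphy, joint continuity, and the dictionary between
  torus points `c` of `Z(P)` and pairs `(u, ζ)`, under which `ψ(c) = log|c₁| - a log|c₀| - Re b`
  (`rfPsi`) becomes `log|u|`.
* Part B — `Φ_u ≢ 0` for `u ≠ 0`, `P ≠ 0` (the rotations `e^{2πi n a}` are pairwise distinct).
* Part C — MONOMIAL DOMINATION (the input replacing any local analysis of the curve): for `a ∉ ℚ`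
  the weights `i + a j` of the monomials of `P` are pairwise distinct, so on the part of the torus
  curve where `ψ` is bounded, `log|c₀|` is bounded (`abs_log_norm_le_of_eval_eq_zero`).
-/

noncomputable section

open Filter Topology Metric Set Complex Bornology
open Literature.NumberTheory.Transcendental Literature.ModelTheory.Zilber
open Literature.ModelTheory.ExponentialFields

set_option linter.dupNamespace false

namespace Summit.Schanuel.Schanuel.Theorems

/-! ## Part A. The twisted curve function -/

section Setup

/-- The twisted fibre point `(e^ζ, u·e^{aζ+b}) ∈ ℂ²`. (new) -/
def rfPt (a : ℝ) (b u ζ : ℂ) : Fin 2 → ℂ := ![exp ζ, u * exp ((a : ℂ) * ζ + b)]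

/-- The twisted curve function `Φ_u(ζ) = P(e^ζ, u·e^{aζ+b})`; for `u = 1` its zeros are exactly the
exponential points of `{x₁ = a x₀ + b} × Z(P)`. (new) -/
def curveFn (a : ℝ) (b : ℂ) (P : MvPolynomial (Fin 2) ℂ) (u ζ : ℂ) : ℂ :=
  MvPolynomial.eval (rfPt a b u ζ) P

/-- The level functional `ψ(c) = log|c₁| - a·log|c₀| - Re b` on `ℂ²`. (new) -/
def rfPsi (a : ℝ) (b : ℂ) (c : Fin 2 → ℂ) : ℝ := Real.log ‖c 1‖ - a * Real.log ‖c 0‖ - b.re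

/-- First coordinate of the twisted fibre point. -/
@[simp] theorem rfPt_zero (a : ℝ) (b u ζ : ℂ) : rfPt a b u ζ 0 = exp ζ := rfl

/-- Second coordinate of the twisted fibre point. -/
@[simp] theorem rfPt_one (a : ℝ) (b u ζ : ℂ) : rfPt a b u ζ 1 = u * exp ((a : ℂ) * ζ + b) := rfl

/-- Any `c : Fin 2 → ℂ` is `![c 0, c 1]`. -/
theorem rf_eq_vec_two (c : Fin 2 → ℂ) : c = ![c 0, c 1] := by
  funext i; fin_cases i <;> rfl

/-- **Window periodicity**: `(e^{ζ+2πin}, u e^{a(ζ+2πin)+b}) = (e^ζ, (u e^{2πi n a}) e^{aζ+b})`. -/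
theorem rfPt_add_int_mul (a : ℝ) (b u ζ : ℂ) (n : ℤ) :
    rfPt a b u (ζ + n * (2 * Real.pi * I)) = rfPt a b (u * urot (n * a)) ζ := by
  funext i; fin_cases i
  · simp [rfPt, Complex.exp_add, Complex.exp_int_mul_two_pi_mul_I]
  · simp only [rfPt, Fin.mk_one, Matrix.cons_val_one, Matrix.cons_val_zero]
    have h : (a : ℂ) * (ζ + n * (2 * Real.pi * I)) + b =
        ((a : ℂ) * ζ + b) + ((n * a : ℝ) : ℂ) * (2 * Real.pi * I) := by
      push_cast; ring
    rw [h, Complex.exp_add, urot]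
    ring

/-- `Φ_u(ζ + 2πi n) = Φ_{u e^{2πi n a}}(ζ)`. -/
theorem curveFn_add_int_mul (a : ℝ) (b : ℂ) (P : MvPolynomial (Fin 2) ℂ) (u ζ : ℂ) (n : ℤ) :
    curveFn a b P u (ζ + n * (2 * Real.pi * I)) = curveFn a b P (u * urot (n * a)) ζ := by
  rw [curveFn, curveFn, rfPt_add_int_mul]

/-- `(u, ζ) ↦ (e^ζ, u e^{aζ+b})` is continuous. -/
theorem continuous_rfPt (a : ℝ) (b : ℂ) : Continuous fun p : ℂ × ℂ => rfPt a b p.1 p.2 := by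
  refine continuous_pi fun i => ?_
  fin_cases i
  · show Continuous fun p : ℂ × ℂ => exp p.2
    exact Complex.continuous_exp.comp continuous_snd
  · show Continuous fun p : ℂ × ℂ => p.1 * exp ((a : ℂ) * p.2 + b)
    exact continuous_fst.mul (Complex.continuous_exp.comp
      ((continuous_const.mul continuous_snd).add continuous_const))

/-- `(u, ζ) ↦ Φ_u(ζ)` is continuous. -/
theorem continuous_curveFn (a : ℝ) (b : ℂ) (P : MvPolynomial (Fin 2) ℂ) :
    Continuous fun p : ℂ × ℂ => curveFn a b P p.1 p.2 :=
  (MvPolynomial.continuous_eval P).comp (continuous_rfPt a b)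

/-- `ζ ↦ Φ_u(ζ)` is entire. -/
theorem differentiable_curveFn (a : ℝ) (b : ℂ) (P : MvPolynomial (Fin 2) ℂ) (u : ℂ) :
    Differentiable ℂ (curveFn a b P u) := by
  intro z
  have h1 : Differentiable ℂ fun ζ : ℂ => u * exp ((a : ℂ) * ζ + b) :=
    (Complex.differentiable_exp.comp
      (((differentiable_const _).mul differentiable_id).add (differentiable_const _))).const_mul u
  have h : AnalyticAt ℂ (fun ζ => MvPolynomial.aeval (rfPt a b u ζ) P) z := by
    refine AnalyticAt.aeval_mvPolynomial (fun i => ?_) P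
    fin_cases i
    · show AnalyticAt ℂ (fun ζ : ℂ => exp ζ) z
      exact Complex.differentiable_exp.analyticAt z
    · show AnalyticAt ℂ (fun ζ : ℂ => u * exp ((a : ℂ) * ζ + b)) z
      exact h1.analyticAt z
  have h' := h.differentiableAt
  simp only [MvPolynomial.aeval_eq_eval] at h'
  exact h'

/-- For `u ≠ 0` the twisted fibre point lies in the torus `(ℂˣ)²`. -/
theorem rfPt_ne_zero (a : ℝ) (b : ℂ) {u : ℂ} (hu : u ≠ 0) (ζ : ℂ) (i : Fin 2) :
    rfPt a b u ζ i ≠ 0 := by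
  fin_cases i
  · exact Complex.exp_ne_zero _
  · exact mul_ne_zero hu (Complex.exp_ne_zero _)

/-- `Re (a ζ + b) = a Re ζ + Re b` for real `a`. -/
theorem rf_re_line (a : ℝ) (b ζ : ℂ) : ((a : ℂ) * ζ + b).re = a * ζ.re + b.re := by
  simp [Complex.add_re, Complex.mul_re]

/-- **Dictionary, `(u, ζ) ↦ c`**: `ψ(e^ζ, u e^{aζ+b}) = log|u|`. -/
theorem rfPsi_rfPt (a : ℝ) (b : ℂ) {u : ℂ} (hu : u ≠ 0) (ζ : ℂ) :
    rfPsi a b (rfPt a b u ζ) = Real.log ‖u‖ := by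
  simp only [rfPsi, rfPt_one, rfPt_zero, norm_mul, Complex.norm_exp, rf_re_line]
  rw [Real.log_mul (norm_ne_zero_iff.2 hu) (Real.exp_pos _).ne', Real.log_exp, Real.log_exp]
  ring

/-- **Dictionary, `c ↦ (u, ζ)`**: a torus point `c` is `(e^x, u e^{ax+b})` with `x = log c₀`,
`u = c₁ e^{-(ax+b)}`, and then `log|u| = ψ(c)`. -/
theorem exists_rfPt_eq {a : ℝ} {b : ℂ} {c : Fin 2 → ℂ} (h0 : c 0 ≠ 0) (h1 : c 1 ≠ 0) :
    ∃ u x : ℂ, u ≠ 0 ∧ rfPt a b u x = c ∧ Real.log ‖u‖ = rfPsi a b c := by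
  set x := Complex.log (c 0) with hx
  set u := c 1 * exp (-((a : ℂ) * x + b)) with hu
  have hu0 : u ≠ 0 := mul_ne_zero h1 (Complex.exp_ne_zero _)
  have hpt : rfPt a b u x = c := by
    rw [rf_eq_vec_two c]
    funext i
    fin_cases i
    · simp [rfPt, hx, Complex.exp_log h0]
    · show u * exp ((a : ℂ) * x + b) = c 1
      rw [hu, mul_assoc, ← Complex.exp_add, neg_add_cancel, Complex.exp_zero, mul_one]
  refine ⟨u, x, hu0, hpt, ?_⟩
  rw [← rfPsi_rfPt a b hu0 x, hpt]

/-- `ψ` is continuous at every torus point. -/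
theorem continuousAt_rfPsi (a : ℝ) (b : ℂ) {c : Fin 2 → ℂ} (h0 : c 0 ≠ 0) (h1 : c 1 ≠ 0) :
    ContinuousAt (rfPsi a b) c := by
  have hn : ∀ i, Continuous fun c : Fin 2 → ℂ => ‖c i‖ := fun i => (continuous_apply i).norm
  have hc0 : ContinuousAt (fun c : Fin 2 → ℂ => Real.log ‖c 0‖) c :=
    ContinuousAt.comp (g := Real.log) (Real.continuousAt_log (norm_ne_zero_iff.2 h0))
      (hn 0).continuousAt
  have hc1 : ContinuousAt (fun c : Fin 2 → ℂ => Real.log ‖c 1‖) c :=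
    ContinuousAt.comp (g := Real.log) (Real.continuousAt_log (norm_ne_zero_iff.2 h1))
      (hn 1).continuousAt
  exact (hc1.sub (continuousAt_const.mul hc0)).sub continuousAt_const

end Setup

/-! ## Part B. `Φ_u ≢ 0` -/

section Nonvanishing

/-- A polynomial in `ℂ[y₀, y₁]` vanishing, for every `s` in an infinite set, at infinitely many
points `(s, t)`, is zero. [folklore] -/
theorem rf_mvPolynomial_eq_zero_of_infinite_fibres (P : MvPolynomial (Fin 2) ℂ) {S : Set ℂ}
    (hS : S.Infinite) (h : ∀ s ∈ S, {t : ℂ | MvPolynomial.eval ![s, t] P = 0}.Infinite) :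
    P = 0 := by
  -- every vertical slice is a polynomial function of `t`
  have hslice : ∀ s : ℂ, ∃ q : Polynomial ℂ, ∀ t, MvPolynomial.eval ![s, t] P = q.eval t := by
    intro s
    refine ⟨MvPolynomial.aeval ![Polynomial.C s, Polynomial.X] P, fun t => ?_⟩
    have hcomp : (Polynomial.aeval t).comp (MvPolynomial.aeval ![Polynomial.C s, Polynomial.X]) =
        MvPolynomial.aeval ![s, t] := by
      rw [MvPolynomial.comp_aeval]
      congr 1
      funext i
      fin_cases i <;> simp
    have h := DFunLike.congr_fun hcomp P
    rw [AlgHom.comp_apply, Polynomial.coe_aeval_eq_eval] at h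
    exact h.symm
  have hzero : ∀ s ∈ S, ∀ t, MvPolynomial.eval ![s, t] P = 0 := by
    intro s hs t
    obtain ⟨q, hq⟩ := hslice s
    have hq0 : q = 0 := by
      refine Polynomial.eq_zero_of_infinite_isRoot q ((h s hs).mono fun t ht => ?_)
      have ht' : MvPolynomial.eval ![s, t] P = 0 := ht
      rwa [hq t] at ht'
    rw [hq t, hq0, Polynomial.eval_zero]
  have key := MvPolynomial.funext_set (p := P) (q := 0) ![S, Set.univ] (fun i => by
    fin_cases i
    exacts [hS, Set.infinite_univ]) (fun x hx => by
    rw [map_zero, rf_eq_vec_two x]; exact hzero _ (hx 0 (Set.mem_univ _)) _)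
  exact key

/-- The rotations `e^{2πi n a}`, `n ∈ ℤ`, are pairwise distinct for irrational `a`. -/
theorem urot_int_mul_injective {a : ℝ} (ha : Irrational a) :
    Function.Injective fun n : ℤ => urot (n * a) := by
  intro n m h
  obtain ⟨k, hk⟩ := Complex.exp_eq_exp_iff_exists_int.1 h
  have h2 : (2 * Real.pi * I : ℂ) ≠ 0 := by simp [Real.pi_ne_zero, Complex.I_ne_zero]
  have hk' : (((n * a : ℝ)) : ℂ) = ((m * a : ℝ) : ℂ) + k := by
    apply mul_right_cancel₀ h2; rw [hk]; ring
  have hre : (n : ℝ) * a = m * a + k := by simpa using congrArg Complex.re hk'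
  by_contra hnm
  have hnm' : ((n : ℝ) - m) ≠ 0 := by rw [sub_ne_zero]; exact_mod_cast hnm
  refine (irrational_iff_ne_rational a).1 ha k (n - m) (by exact_mod_cast (sub_ne_zero.2 hnm)) ?_
  rw [Int.cast_sub]
  exact eq_div_of_mul_eq hnm' (by linear_combination hre)

/-- **`Φ_u ≢ 0`** for `u ≠ 0`, `P ≠ 0`, `a ∉ ℚ`: otherwise, reading `Φ_u` in the windows
`ζ + 2πi n`, `P(s, ·)` would vanish at the infinitely many points `u e^{2πi n a} e^{aζ+b}` for every
`s = e^ζ ∈ ℂˣ`. (new) -/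
theorem exists_curveFn_ne_zero {a : ℝ} (ha : Irrational a) (b : ℂ) {P : MvPolynomial (Fin 2) ℂ}
    (hP : P ≠ 0) {u : ℂ} (hu : u ≠ 0) : ∃ ζ, curveFn a b P u ζ ≠ 0 := by
  by_contra! h
  apply hP
  refine rf_mvPolynomial_eq_zero_of_infinite_fibres P (S := {s : ℂ | s ≠ 0})
    (Set.finite_singleton (0 : ℂ)).infinite_compl ?_
  intro s hs
  have hs0 : s ≠ 0 := hs
  set ζ := Complex.log s with hζ
  set v := exp ((a : ℂ) * ζ + b) with hv
  have hroot : ∀ n : ℤ, MvPolynomial.eval ![s, u * urot (n * a) * v] P = 0 := by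
    intro n
    have h1 := h (ζ + n * (2 * Real.pi * I))
    rw [curveFn_add_int_mul, curveFn] at h1
    have e : rfPt a b (u * urot (n * a)) ζ = ![s, u * urot (n * a) * v] := by
      funext i
      fin_cases i
      · simp [rfPt, hζ, Complex.exp_log hs0]
      · simp [rfPt, hv]
    rwa [e] at h1
  have hinj : Function.Injective fun n : ℤ => u * urot (n * a) * v := by
    intro n m hnm
    have hv0 : v ≠ 0 := Complex.exp_ne_zero _
    have h1 : urot (n * a) = urot (m * a) := by
      have := hnm
      simp only at this
      exact mul_left_cancel₀ hu (mul_right_cancel₀ hv0 this)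
    exact urot_int_mul_injective ha h1
  exact Set.infinite_of_injective_forall_mem hinj hroot

end Nonvanishing

/-! ## Part C. Monomial domination on the torus curve -/

section Domination

/-- **Abstract domination.** Finitely many terms `p_α e^{w_α s + κ_α τ}` with positive `p_α`
and a STRICTLY largest weight `w_{α₀}`: if the top term is bounded by the sum of the others while
`|τ| ≤ T`, then `s` is bounded above (by a constant depending only on the data). [folklore] -/
theorem rf_exists_bound_of_dominated {ι : Type*} [DecidableEq ι] (F : Finset ι) (w κ p : ι → ℝ)
    (hp : ∀ α ∈ F, 0 < p α) {α₀ : ι} (hα₀ : α₀ ∈ F) (hmax : ∀ α ∈ F, α ≠ α₀ → w α < w α₀)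
    (T : ℝ) :
    ∃ K : ℝ, ∀ s τ : ℝ, |τ| ≤ T →
      p α₀ * Real.exp (w α₀ * s + κ α₀ * τ) ≤
        ∑ α ∈ F.erase α₀, p α * Real.exp (w α * s + κ α * τ) → s ≤ K := by
  by_cases hne : (F.erase α₀).Nonempty
  swap
  · refine ⟨0, fun s τ _ hle => ?_⟩
    rw [Finset.not_nonempty_iff_eq_empty.1 hne, Finset.sum_empty] at hle
    exact absurd hle (not_le.2 (mul_pos (hp α₀ hα₀) (Real.exp_pos _)))
  set F' := F.erase α₀ with hF'
  obtain ⟨α₁, hα₁, hsup⟩ := Finset.exists_mem_eq_sup' hne w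
  set w₁ := F'.sup' hne w with hw₁def
  have hw₁ : ∀ α ∈ F', w α ≤ w₁ := fun α hα => Finset.le_sup' w hα
  have hγ : 0 < w α₀ - w₁ := by
    have := hmax α₁ (Finset.mem_of_mem_erase hα₁) (Finset.ne_of_mem_erase hα₁); linarith
  set k := F.sup' ⟨α₀, hα₀⟩ (fun α => |κ α|) with hkdef
  have hk : ∀ α ∈ F, |κ α| ≤ k := fun α hα => Finset.le_sup' (fun α => |κ α|) hα
  have hk0 : 0 ≤ k := (abs_nonneg _).trans (hk α₀ hα₀)
  set A := ∑ α ∈ F', p α with hAdef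
  have hA : 0 < A := Finset.sum_pos (fun α hα => hp α (Finset.mem_of_mem_erase hα)) hne
  have hp0 := hp α₀ hα₀
  refine ⟨max 0 ((Real.log (A / p α₀) + 2 * k * T) / (w α₀ - w₁)), fun s τ hτ hle => ?_⟩
  rcases le_or_gt s 0 with hs | hs
  · exact hs.trans (le_max_left _ _)
  refine le_trans ?_ (le_max_right _ _)
  have hterm : ∀ α ∈ F', p α * Real.exp (w α * s + κ α * τ) ≤ p α * Real.exp (w₁ * s + k * T) := by
    intro α hα
    refine mul_le_mul_of_nonneg_left (Real.exp_le_exp.2 ?_) (hp α (Finset.mem_of_mem_erase hα)).le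
    have h1 : w α * s ≤ w₁ * s := mul_le_mul_of_nonneg_right (hw₁ α hα) hs.le
    have h2 : κ α * τ ≤ k * T := by
      calc κ α * τ ≤ |κ α * τ| := le_abs_self _
        _ = |κ α| * |τ| := abs_mul _ _
        _ ≤ k * T := mul_le_mul (hk α (Finset.mem_of_mem_erase hα)) hτ (abs_nonneg _) hk0
    linarith
  have hrhs : ∑ α ∈ F', p α * Real.exp (w α * s + κ α * τ) ≤ A * Real.exp (w₁ * s + k * T) := by
    rw [hAdef, Finset.sum_mul]; exact Finset.sum_le_sum hterm
  have hlhs : p α₀ * Real.exp (w α₀ * s - k * T) ≤ p α₀ * Real.exp (w α₀ * s + κ α₀ * τ) := by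
    refine mul_le_mul_of_nonneg_left (Real.exp_le_exp.2 ?_) hp0.le
    have h := neg_abs_le (κ α₀ * τ)
    have : |κ α₀| * |τ| ≤ k * T := mul_le_mul (hk α₀ hα₀) hτ (abs_nonneg _) hk0
    rw [abs_mul] at h; linarith
  have key : p α₀ * Real.exp (w α₀ * s - k * T) ≤ A * Real.exp (w₁ * s + k * T) :=
    hlhs.trans (hle.trans hrhs)
  have key2 : Real.exp ((w α₀ - w₁) * s - 2 * k * T) ≤ A / p α₀ := by
    rw [le_div_iff₀ hp0]
    have e : Real.exp ((w α₀ - w₁) * s - 2 * k * T) * p α₀ =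
        p α₀ * Real.exp (w α₀ * s - k * T) / Real.exp (w₁ * s + k * T) := by
      rw [mul_comm, mul_div_assoc, ← Real.exp_sub]; ring_nf
    rw [e, div_le_iff₀ (Real.exp_pos _)]; exact key
  have key3 : (w α₀ - w₁) * s - 2 * k * T ≤ Real.log (A / p α₀) := by
    rw [← Real.exp_le_exp, Real.exp_log (div_pos hA hp0)]; exact key2
  rw [le_div_iff₀ hγ]; linarith

/-- The weight `i + a j` of the monomial `y₀^i y₁^j`, signed by `σ`. (new) -/
def rfWeight (a σ : ℝ) (α : Fin 2 →₀ ℕ) : ℝ := σ * ((α 0 : ℝ) + a * α 1)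

/-- For `a ∉ ℚ` and `σ ≠ 0` the weights `σ (i + a j)` are pairwise distinct. -/
theorem rfWeight_injective {a : ℝ} (ha : Irrational a) {σ : ℝ} (hσ : σ ≠ 0) :
    Function.Injective (rfWeight a σ) := by
  intro α β h
  simp only [rfWeight] at h
  have h' : (α 0 : ℝ) + a * α 1 = β 0 + a * β 1 := mul_left_cancel₀ hσ h
  have h1 : α 1 = β 1 := by
    by_contra hne
    have hne' : ((α 1 : ℝ) - β 1) ≠ 0 := by rw [sub_ne_zero]; exact_mod_cast hne
    have hneZ : ((α 1 : ℤ) - β 1) ≠ 0 := by rw [sub_ne_zero]; exact_mod_cast hne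
    refine (irrational_iff_ne_rational a).1 ha ((β 0 : ℤ) - α 0) ((α 1 : ℤ) - β 1) hneZ ?_
    push_cast
    exact eq_div_of_mul_eq hne' (by linear_combination h')
  have h0 : α 0 = β 0 := by
    rw [h1] at h'; exact_mod_cast (add_right_cancel h')
  ext i; fin_cases i; exacts [h0, h1]

/-- Norm of a monomial term at a torus point, in logarithmic coordinates
`s = log|c₀|`, `τ = log|c₁| - a log|c₀|`. -/
theorem rf_norm_coeff_mul_prod (a : ℝ) (P : MvPolynomial (Fin 2) ℂ) (α : Fin 2 →₀ ℕ)
    {c : Fin 2 → ℂ} (h0 : c 0 ≠ 0) (h1 : c 1 ≠ 0) :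
    ‖P.coeff α * ∏ i, c i ^ α i‖ = ‖P.coeff α‖ *
      Real.exp (((α 0 : ℝ) + a * α 1) * Real.log ‖c 0‖ +
        α 1 * (Real.log ‖c 1‖ - a * Real.log ‖c 0‖)) := by
  rw [norm_mul, Fin.prod_univ_two, norm_mul, norm_pow, norm_pow]
  have e0 : ‖c 0‖ ^ (α 0) = Real.exp (α 0 * Real.log ‖c 0‖) := by
    rw [Real.exp_nat_mul, Real.exp_log (norm_pos_iff.2 h0)]
  have e1 : ‖c 1‖ ^ (α 1) = Real.exp (α 1 * Real.log ‖c 1‖) := by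
    rw [Real.exp_nat_mul, Real.exp_log (norm_pos_iff.2 h1)]
  rw [e0, e1, ← Real.exp_add]
  congr 1
  ring_nf

/-- **One-sided domination on the torus curve**: for `P ≠ 0`, `a ∉ ℚ`, `σ = ±1`, on
`{c ∈ Z(P) ∩ (ℂˣ)² : |log|c₁| - a log|c₀|| ≤ T}` the quantity `σ log|c₀|` is bounded above. -/
theorem sign_mul_log_norm_le_of_eval_eq_zero {a : ℝ} (ha : Irrational a)
    {P : MvPolynomial (Fin 2) ℂ} (hP : P ≠ 0) {σ : ℝ} (hσ : σ * σ = 1) (T : ℝ) :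
    ∃ K : ℝ, ∀ c : Fin 2 → ℂ, c 0 ≠ 0 → c 1 ≠ 0 → MvPolynomial.eval c P = 0 →
      |Real.log ‖c 1‖ - a * Real.log ‖c 0‖| ≤ T → σ * Real.log ‖c 0‖ ≤ K := by
  classical
  have hσ0 : σ ≠ 0 := by
    rintro rfl; simp at hσ
  have hne : P.support.Nonempty := by
    rw [Finset.nonempty_iff_ne_empty, Ne, MvPolynomial.support_eq_empty]
    exact hP
  obtain ⟨α₀, hα₀, hmax⟩ := Finset.exists_max_image P.support (rfWeight a σ) hne
  have hmax' : ∀ α ∈ P.support, α ≠ α₀ → rfWeight a σ α < rfWeight a σ α₀ :=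
    fun α hα hne => lt_of_le_of_ne (hmax α hα)
      (fun h => hne (rfWeight_injective ha hσ0 h))
  obtain ⟨K, hK⟩ := rf_exists_bound_of_dominated P.support (rfWeight a σ) (fun α => (α 1 : ℝ))
    (fun α => ‖P.coeff α‖) (fun α hα => norm_pos_iff.2 (MvPolynomial.mem_support_iff.1 hα))
    hα₀ hmax' T
  refine ⟨K, fun c h0 h1 hc hT => hK (σ * Real.log ‖c 0‖) _ hT ?_⟩
  -- the balance inequality from `P(c) = 0`
  have hnorm : ∀ α : Fin 2 →₀ ℕ, ‖P.coeff α * ∏ i, c i ^ α i‖ =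
      ‖P.coeff α‖ * Real.exp (rfWeight a σ α * (σ * Real.log ‖c 0‖) +
        α 1 * (Real.log ‖c 1‖ - a * Real.log ‖c 0‖)) := by
    intro α
    rw [rf_norm_coeff_mul_prod a P α h0 h1]
    congr 2
    simp only [rfWeight]
    linear_combination (-(((α 0 : ℝ) + a * α 1) * Real.log ‖c 0‖)) * hσ
  have hsum : ∑ α ∈ P.support, P.coeff α * ∏ i, c i ^ α i = 0 := by
    rw [← hc, MvPolynomial.eval_eq']
  rw [← Finset.add_sum_erase _ _ hα₀] at hsum
  have hle : ‖P.coeff α₀ * ∏ i, c i ^ α₀ i‖ ≤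
      ∑ α ∈ P.support.erase α₀, ‖P.coeff α * ∏ i, c i ^ α i‖ := by
    rw [eq_neg_of_add_eq_zero_left hsum, norm_neg]; exact norm_sum_le _ _
  simpa only [hnorm] using hle

/-- **Monomial domination**: for `P ≠ 0` and `a ∉ ℚ`, on the part of the torus curve
`Z(P) ∩ (ℂˣ)²` where `|log|c₁| - a log|c₀|| ≤ T`, `|log|c₀||` is bounded. (new) -/
theorem abs_log_norm_le_of_eval_eq_zero {a : ℝ} (ha : Irrational a)
    {P : MvPolynomial (Fin 2) ℂ} (hP : P ≠ 0) (T : ℝ) :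
    ∃ K : ℝ, ∀ c : Fin 2 → ℂ, c 0 ≠ 0 → c 1 ≠ 0 → MvPolynomial.eval c P = 0 →
      |Real.log ‖c 1‖ - a * Real.log ‖c 0‖| ≤ T → |Real.log ‖c 0‖| ≤ K := by
  obtain ⟨K₁, hK₁⟩ := sign_mul_log_norm_le_of_eval_eq_zero ha hP (σ := 1) (by norm_num) T
  obtain ⟨K₂, hK₂⟩ := sign_mul_log_norm_le_of_eval_eq_zero ha hP (σ := -1) (by norm_num) T
  refine ⟨max K₁ K₂, fun c h0 h1 hc hT => abs_le.2 ⟨?_, ?_⟩⟩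
  · have := hK₂ c h0 h1 hc hT; have h2 := le_max_right K₁ K₂; linarith
  · have := hK₁ c h0 h1 hc hT; have h2 := le_max_left K₁ K₂; linarith

end Domination

end Summit.Schanuel.Schanuel.Theorems
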